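import Mathlib
import Summits.KontsevichZagierPeriods.Zeta5Search.UniversalDigit
import Summits.KontsevichZagierPeriods.Zeta5Search.GHatClassCongr
import Summits.KontsevichZagierPeriods.Zeta5Search.GHatConj
import Summits.KontsevichZagierPeriods.Zeta5Search.GHatShift
import Summits.KontsevichZagierPeriods.Zeta5Search.UniversalDigitW
import Summits.KontsevichZagierPeriods.Zeta5Search.UniversalDigitV
import HarnessLib

/-!
# ζ(5) search — gen-2 g9's universal-digit statements G1, G2, G3, U-W, U-V are THEOREMS (by-name discharges)

Cell `pub-zeta5` (HONEST FRAMING: systematic search; no irrationality claim unless certified), typer seat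
generation 9 (filing lane).  P1 g5 proved the statement BODIES of five `@[conjecture]` declarations of
`Zeta5Search/UniversalDigit.lean` (gen-2 g9, REPORT-gen2-g9 §1) before that statement file was in the tree — in namespace `CellA`,
with their own copies of the type invariants `classPoles`, `wHat`, `vHat` (identical bodies).  This file records the discharges
BY NAME, as P1 g5 requested (INBOX 2026-08-20): nothing is re-proved here.

* `gHatClassCongr_holds : GHatClassCongr` (G1, `CellA.gHat_classCongr`, p219464);
* `gHatConj_holds : GHatConj` (G2, `CellA.gHat_conj`, p220061);
* `gHatShift_holds : GHatShift` (G3, `CellA.gHat_shift`, p219599);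
* `wDigit_holds : WDigit` (U-W, `CellA.wDigit`, p219888);
* `vDigit_holds : VDigit` (U-V, `CellA.vDigit`, p220134).
`p`-adic valuations of rational numbers; nothing about irrationality.
-/

noncomputable section

namespace Summit.KontsevichZagierPeriods.Zeta5Search.ClusterValuation

/-- P1's `CellA.wHat` is gen-2's `wHat`. -/
theorem cellA_wHat_eq : @CellA.wHat = @wHat := rfl

/-- P1's `CellA.vHat` is gen-2's `vHat`. -/
theorem cellA_vHat_eq : @CellA.vHat = @vHat := rfl

/-- **G1 is a theorem** (P1 g5). -/
theorem gHatClassCongr_holds : GHatClassCongr := CellA.gHat_classCongr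

/-- **G2 is a theorem** (P1 g5). -/
theorem gHatConj_holds : GHatConj := CellA.gHat_conj

/-- **G3 is a theorem** (P1 g5). -/
theorem gHatShift_holds : GHatShift := CellA.gHat_shift

/-- **U-W is a theorem** (P1 g5). -/
theorem wDigit_holds : WDigit := by
  have h := @CellA.wDigit
  rw [cellA_wHat_eq] at h
  exact h

/-- **U-V is a theorem** (P1 g5). -/
theorem vDigit_holds : VDigit := by
  have h := @CellA.vDigit
  rw [cellA_vHat_eq] at h
  exact h

end Summit.KontsevichZagierPeriods.Zeta5Search.ClusterValuation

end
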